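import Summits.ABC.IUTFork.Repair.RHHullThresholdExact
import Summits.ABC.IUTFork.Conditional.WRowHexLamSevenTriplesThirty
import Summits.ABC.IUTFork.Conditional.WRowHexLamSevenThirtyRefutedCellsA
import HarnessLib

/-!
# R-W WINDOW numerics, HEX family `λ_k = 1/2 + 2/7^k` at `k = 30`: the REFUTED BAND's INTEGER CELLS, second half (part (R-cells); the first member's / lower piece lemmas are in `…RefutedCellsA.lean`, the W-lane shapes in `…RefutedBand.lean`) —
# top-label `HullCell` failures over the sharp class for `(ratPoint λ_30, l)` for EVERY prime `481 ≤ l ≤ 4069338436799`, e-robustly and UNIFORMLY in `l`; glue: every prime `11 ≤ l ≤ 4069338436799`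

PROOF-ONLY file (D-0012; 0 definitions, 0 `Prop` facts, no instance, no notation) of the abc-iut cell (W6 cone-prover seat
abc-iut-w6-d055, gen 16; row «W:HEX-AXIS-REST-3», `k = 30`, part (R); generator = abc-iut-C-cert-1 g9's gen_ref.py analytic piece plan run from HOME/staging/w6/w6-d055/g16/hexgen/build3.py; byte models C-cert-1's `k = 22 / 24` files p525962 · p526495 / p526937 · p527491, from the `k = 10` template p508090).
TAKES NO SIDE on [IUTchIII] Cor. 3.12 (S. Mochizuki, *Inter-universal Teichmüller theory III*, Cor. 3.12 p. 173–174; Step (xi-f) p. 184) or on any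
author; «refuted as typed» ≠ «refuted in print». BEFORE THIS FILE (BY NAME): at `k = 30` the K-line object FAILS at every prime `11 ≤ l ≤ 479` (abc-iut-W-neg-2's `HexRad.not_pilotKummerCompatHull_lamSeven_rad_eleven`, every `k ≥ 11`); no theorem names a level `l ≥ 481`.
THIS FILE: at the pole `p = 7` of the HEX30 triple `22539340290692258087863253 + 22539340290692258087863245 = 45078680581384516175726498` (`v = v₇(abc) = 30`; prelude `WRowHexLamSevenTriplesThirty`) abc-iut-W-neg-1's SHARP local-type
class (`WRow.localType_class_triple_sharp`, p498814 §1) leaves `A ∈ {1}`; per member and turning-point piece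
(A = 1: a₀ = 3 on 481 ≤ l ≤ 2057; A = 1: a₀ = 4 on 2059 ≤ l ≤ 14405; A = 1: a₀ = 5 on 14407 ≤ l ≤ 100841; A = 1: a₀ = 6 on 100843 ≤ l ≤ 705893; A = 1: a₀ = 7 on 705895 ≤ l ≤ 4941257; A = 1: a₀ = 8 on 4941259 ≤ l ≤ 34588805; A = 1: a₀ = 9 on 34588807 ≤ l ≤ 242121641; A = 1: a₀ = 10 on 242121643 ≤ l ≤ 1694851493; A = 1: a₀ = 11 on 1694851495 ≤ l ≤ 11863960457; A = 1: a₀ = 12 on 11863960459 ≤ l ≤ 83047723205; A = 1: a₀ = 13 on 83047723207 ≤ l ≤ 581334062441; A = 1: a₀ = 14 on 581334062443 ≤ l ≤ 4069338436823) the top-label cell of R-H row 4's `HullCell` FAILS by a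
floor-free downward parabola (`e·⌊X/e⌋ ≥ X − e + 1`, inner radius bounded by `6·r_in ≤ A·l + 6`), with no exact-floor literal level (the floor-free pieces reach the last refuted prime).
W-neg-1's three sockets (`Cor312LicenceTripleHullCellRefuteTameSharp` §2), transported to `ratPoint ((2 : ℚ)⁻¹ + 2/7^k)`, `k = 30`, give the three W-lane shapes
`WRow.not_licence_lamSeven_thirty_band` / `WRow.not_exists_qPinned_and_hull_lamSeven_thirty_band` / `GenuineK.not_pilotKummerCompatHull_chosen_lamSeven_thirty_band`,
and the GLUE `GenuineK.not_pilotKummerCompatHull_chosen_lamSeven_thirty_le` (every prime `11 ≤ l ≤ 4069338436799`). DESK (three desks agree: abc-iut-rw-num-lead g5's two-engine census HOME/plan/rescue/R-W/HEX-AXIS-CENSUS.tsv 23abd49ba74dfe76 — engine A (python exact) ≡ engine B (PARI, kit j277535) —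
and this seat's generator arithmetic (abc-iut-C-cert-1 g9's analytic piece plan / slot-model check, HOME/staging/w6/w6-d055/g16/hexgen/desk3.py)): the exact top-label cell (inner radius `⌊e/6⌋ + 1`) fails at every prime of the band and first holds at `l = 4069338436831` —
the single CEILING-ONLY level of this axis (`l = 4069338436831`: inhabited only if the inner radius may be read `⌊e/6⌋ + 1`, like `4723` at `k = 10`; NAMED for
abc-iut-W-neg-1's ceiling socket, NOT decided here); the inhabited band `l ≥ 4069338436847` is part (I) (`WRow.licence_lamSeven_thirty_all`), NOT claimed here. These levels are NOT rows of the R-W WINDOW-TABLE.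
HONEST SCOPE: OUR sharp containers and Dupuy–Hilado's typed (Ind1)/(Ind2); the per-label licence is a STRONGER-THAN-PRINT sufficient form of Step (xi-f);
admissibility / Szpiro-badness / (P6) of `(ratPoint λ_30, l)` and NON-EMPTINESS of the datum type are NOT claimed (a «∀ T» statement is vacuous if no datum
exists); nothing about the printed inequality, the number-level `Cor22.Cor312AtDatum` or any author's intended hull; typed ≠ proved; instantiated ≠ endorsed; no abc claim.
[cite: Mochizuki2012, IUTchI Ex. 3.2 (iv) p. 71; IUTchIII Cor. 3.12 Step (xi-d) p. 183, (xi-f) p. 184; IUTchIV Prop. 1.1 p. 9, Prop. 1.2 (i)(ii) p. 10, Thm. 1.10 p. 22, Cor. 2.2 (ii) proof (P5) p. 46]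
[cite: DupuyHilado2025, §3.3, §3.4, §4.9, §4.12] [cite: SilvermanATAEC1994, V.5 Thm. 5.3 and Cor. 5.4] [claim: Mochizuki2012, status: disputed] for every IUT sentence quoted.
-/

noncomputable section

open Set Function NumberField IsDedekindDomain

namespace Summit.ABC.IUTFork.Conditional

open Thm311 Thm311.Real Cor312 Cor312Vol Cor312Prov Literature.IUT.LogThetaLattice Literature.IUT.LogVolume
  Literature.IUT.HodgeTheaters Literature.IUT.LogVolume.ThetaData Literature.IUT.LogVolume.Cor22
open Literature.NumberTheory.NumberFields Literature.NumberTheory.GaloisRepresentations.Ultrametric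
open Literature.NumberTheory.DiophantineGeometry Literature.NumberTheory.DiophantineGeometry.GenEll Summit.ABC.ABC.Theorems
open Summit.ABC.IUTFork.Repair.RH.HullThresholdExact

/-! ## §1. The integer side at `p = 7`, `v = 30`: class `A ∈ {1}`, top label -/

/-- Floor-free failure of the top-label cell, `k = 30`, member `A = 1` (`e = 1l`, `m = 30`), turning point `a₀ = 9` (`r_out = 40353607 − 9·1l`),
every `17294403 ≤ j ≤ 121060820` (`l = 2j + 1`), for ANY inner radius with `6·r_in ≤ 1l + 6` (so for `⌊1l/6⌋ + 1`): `e·⌊X/e⌋ ≥ X − e + 1` and the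
margin is a downward parabola in `j` positive on the range. [folklore] -/
theorem RefBand.not_hullCell_hex30_A1_a9 {j rin : ℤ} (hlo : 17294403 ≤ j) (hhi : j ≤ 121060820) (hrin : 6 * rin ≤ 1 * (2 * j + 1) + 6) :
    ¬ HullCell (1 * (2 * j + 1)) 30 j rin (40353607 - 9 * (1 * (2 * j + 1))) := by
  intro hc
  unfold HullCell at hc
  set e : ℤ := 1 * (2 * j + 1) with he
  have he0 : 0 < e := by rw [he]; omega
  set X : ℤ := j ^ 2 * 30 - j * (e - 1) - (j + 1) * rin with hX
  have hdiv : X - e < e * (X / e) := by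
    have h1 := Int.emod_add_mul_ediv X e
    have h2 := Int.emod_lt_of_pos X he0
    have h3 := Int.emod_nonneg X he0.ne'
    nlinarith [h1, h2, h3]
  have hk1 : 0 ≤ (121060820 - j) * (j + 1) := mul_nonneg (by omega) (by omega)
  have hk2 : 0 ≤ (121060820 - j) * (j - 17294403) := mul_nonneg (by omega) (by omega)
  nlinarith [hdiv, hk1, hk2, hc, hrin, hX]

/-- Floor-free failure of the top-label cell, `k = 30`, member `A = 1` (`e = 1l`, `m = 30`), turning point `a₀ = 10` (`r_out = 282475249 − 10·1l`),
every `121060821 ≤ j ≤ 847425746` (`l = 2j + 1`), for ANY inner radius with `6·r_in ≤ 1l + 6` (so for `⌊1l/6⌋ + 1`): `e·⌊X/e⌋ ≥ X − e + 1` and the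
margin is a downward parabola in `j` positive on the range. [folklore] -/
theorem RefBand.not_hullCell_hex30_A1_a10 {j rin : ℤ} (hlo : 121060821 ≤ j) (hhi : j ≤ 847425746) (hrin : 6 * rin ≤ 1 * (2 * j + 1) + 6) :
    ¬ HullCell (1 * (2 * j + 1)) 30 j rin (282475249 - 10 * (1 * (2 * j + 1))) := by
  intro hc
  unfold HullCell at hc
  set e : ℤ := 1 * (2 * j + 1) with he
  have he0 : 0 < e := by rw [he]; omega
  set X : ℤ := j ^ 2 * 30 - j * (e - 1) - (j + 1) * rin with hX
  have hdiv : X - e < e * (X / e) := by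
    have h1 := Int.emod_add_mul_ediv X e
    have h2 := Int.emod_lt_of_pos X he0
    have h3 := Int.emod_nonneg X he0.ne'
    nlinarith [h1, h2, h3]
  have hk1 : 0 ≤ (847425746 - j) * (j + 1) := mul_nonneg (by omega) (by omega)
  have hk2 : 0 ≤ (847425746 - j) * (j - 121060821) := mul_nonneg (by omega) (by omega)
  nlinarith [hdiv, hk1, hk2, hc, hrin, hX]

/-- Floor-free failure of the top-label cell, `k = 30`, member `A = 1` (`e = 1l`, `m = 30`), turning point `a₀ = 11` (`r_out = 1977326743 − 11·1l`),
every `847425747 ≤ j ≤ 5931980228` (`l = 2j + 1`), for ANY inner radius with `6·r_in ≤ 1l + 6` (so for `⌊1l/6⌋ + 1`): `e·⌊X/e⌋ ≥ X − e + 1` and the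
margin is a downward parabola in `j` positive on the range. [folklore] -/
theorem RefBand.not_hullCell_hex30_A1_a11 {j rin : ℤ} (hlo : 847425747 ≤ j) (hhi : j ≤ 5931980228) (hrin : 6 * rin ≤ 1 * (2 * j + 1) + 6) :
    ¬ HullCell (1 * (2 * j + 1)) 30 j rin (1977326743 - 11 * (1 * (2 * j + 1))) := by
  intro hc
  unfold HullCell at hc
  set e : ℤ := 1 * (2 * j + 1) with he
  have he0 : 0 < e := by rw [he]; omega
  set X : ℤ := j ^ 2 * 30 - j * (e - 1) - (j + 1) * rin with hX
  have hdiv : X - e < e * (X / e) := by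
    have h1 := Int.emod_add_mul_ediv X e
    have h2 := Int.emod_lt_of_pos X he0
    have h3 := Int.emod_nonneg X he0.ne'
    nlinarith [h1, h2, h3]
  have hk1 : 0 ≤ (5931980228 - j) * (j + 1) := mul_nonneg (by omega) (by omega)
  have hk2 : 0 ≤ (5931980228 - j) * (j - 847425747) := mul_nonneg (by omega) (by omega)
  nlinarith [hdiv, hk1, hk2, hc, hrin, hX]

/-- Floor-free failure of the top-label cell, `k = 30`, member `A = 1` (`e = 1l`, `m = 30`), turning point `a₀ = 12` (`r_out = 13841287201 − 12·1l`),
every `5931980229 ≤ j ≤ 41523861602` (`l = 2j + 1`), for ANY inner radius with `6·r_in ≤ 1l + 6` (so for `⌊1l/6⌋ + 1`): `e·⌊X/e⌋ ≥ X − e + 1` and the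
margin is a downward parabola in `j` positive on the range. [folklore] -/
theorem RefBand.not_hullCell_hex30_A1_a12 {j rin : ℤ} (hlo : 5931980229 ≤ j) (hhi : j ≤ 41523861602) (hrin : 6 * rin ≤ 1 * (2 * j + 1) + 6) :
    ¬ HullCell (1 * (2 * j + 1)) 30 j rin (13841287201 - 12 * (1 * (2 * j + 1))) := by
  intro hc
  unfold HullCell at hc
  set e : ℤ := 1 * (2 * j + 1) with he
  have he0 : 0 < e := by rw [he]; omega
  set X : ℤ := j ^ 2 * 30 - j * (e - 1) - (j + 1) * rin with hX
  have hdiv : X - e < e * (X / e) := by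
    have h1 := Int.emod_add_mul_ediv X e
    have h2 := Int.emod_lt_of_pos X he0
    have h3 := Int.emod_nonneg X he0.ne'
    nlinarith [h1, h2, h3]
  have hk1 : 0 ≤ (41523861602 - j) * (j + 1) := mul_nonneg (by omega) (by omega)
  have hk2 : 0 ≤ (41523861602 - j) * (j - 5931980229) := mul_nonneg (by omega) (by omega)
  nlinarith [hdiv, hk1, hk2, hc, hrin, hX]

/-- Floor-free failure of the top-label cell, `k = 30`, member `A = 1` (`e = 1l`, `m = 30`), turning point `a₀ = 13` (`r_out = 96889010407 − 13·1l`),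
every `41523861603 ≤ j ≤ 290667031220` (`l = 2j + 1`), for ANY inner radius with `6·r_in ≤ 1l + 6` (so for `⌊1l/6⌋ + 1`): `e·⌊X/e⌋ ≥ X − e + 1` and the
margin is a downward parabola in `j` positive on the range. [folklore] -/
theorem RefBand.not_hullCell_hex30_A1_a13 {j rin : ℤ} (hlo : 41523861603 ≤ j) (hhi : j ≤ 290667031220) (hrin : 6 * rin ≤ 1 * (2 * j + 1) + 6) :
    ¬ HullCell (1 * (2 * j + 1)) 30 j rin (96889010407 - 13 * (1 * (2 * j + 1))) := by
  intro hc
  unfold HullCell at hc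
  set e : ℤ := 1 * (2 * j + 1) with he
  have he0 : 0 < e := by rw [he]; omega
  set X : ℤ := j ^ 2 * 30 - j * (e - 1) - (j + 1) * rin with hX
  have hdiv : X - e < e * (X / e) := by
    have h1 := Int.emod_add_mul_ediv X e
    have h2 := Int.emod_lt_of_pos X he0
    have h3 := Int.emod_nonneg X he0.ne'
    nlinarith [h1, h2, h3]
  have hk1 : 0 ≤ (290667031220 - j) * (j + 1) := mul_nonneg (by omega) (by omega)
  have hk2 : 0 ≤ (290667031220 - j) * (j - 41523861603) := mul_nonneg (by omega) (by omega)
  nlinarith [hdiv, hk1, hk2, hc, hrin, hX]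

/-- Floor-free failure of the top-label cell, `k = 30`, member `A = 1` (`e = 1l`, `m = 30`), turning point `a₀ = 14` (`r_out = 678223072849 − 14·1l`),
every `290667031221 ≤ j ≤ 2034669218411` (`l = 2j + 1`), for ANY inner radius with `6·r_in ≤ 1l + 6` (so for `⌊1l/6⌋ + 1`): `e·⌊X/e⌋ ≥ X − e + 1` and the
margin is a downward parabola in `j` positive on the range. [folklore] -/
theorem RefBand.not_hullCell_hex30_A1_a14 {j rin : ℤ} (hlo : 290667031221 ≤ j) (hhi : j ≤ 2034669218411) (hrin : 6 * rin ≤ 1 * (2 * j + 1) + 6) :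
    ¬ HullCell (1 * (2 * j + 1)) 30 j rin (678223072849 - 14 * (1 * (2 * j + 1))) := by
  intro hc
  unfold HullCell at hc
  set e : ℤ := 1 * (2 * j + 1) with he
  have he0 : 0 < e := by rw [he]; omega
  set X : ℤ := j ^ 2 * 30 - j * (e - 1) - (j + 1) * rin with hX
  have hdiv : X - e < e * (X / e) := by
    have h1 := Int.emod_add_mul_ediv X e
    have h2 := Int.emod_lt_of_pos X he0
    have h3 := Int.emod_nonneg X he0.ne'
    nlinarith [h1, h2, h3]
  have hk1 : 0 ≤ (2034669218411 - j) * (j + 1) := mul_nonneg (by omega) (by omega)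
  have hk2 : 0 ≤ (2034669218411 - j) * (j - 290667031221) := mul_nonneg (by omega) (by omega)
  nlinarith [hdiv, hk1, hk2, hc, hrin, hX]

/-- **The engine's `hcell` for the HEX30 triple at `p = 7` (`v = 30`), odd `481 ≤ l ≤ 4069338436823`, top label.** The sharp clauses force
`A ∈ {1}`; per member and turning-point piece the cell fails by the floor-free lemmas above, at the literal levels by the exact floor. [folklore] -/
theorem RefBand.cells_hex30_band {l : ℕ} (hlo : 481 ≤ l) (hhi : l ≤ 4069338436823) (hodd : Odd l) {i : ℕ} (hi : i + 1 = (l - 1) / 2)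
    (A : ℕ) (hA30 : A ∣ 30) (hA15 : 15 ∣ A * 30) (hAev : Even 30 → A ∣ 15) (hA3 : 3 ∣ 30 → A ∣ 10) (hA5 : 5 ∣ 30 → A ∣ 6) :
    ∃ a₀ : ℕ, (∀ s : ℕ, s < a₀ → (1 : ℤ) * ((7 : ℕ) : ℤ) ^ s * (((7 : ℕ) : ℤ) - 1) < ((A * l : ℕ) : ℤ)) ∧
      ((A * l : ℕ) : ℤ) ≤ 1 * ((7 : ℕ) : ℤ) ^ a₀ * (((7 : ℕ) : ℤ) - 1) ∧
      ¬ HullCell ((A * l : ℕ) : ℤ) ((A * 30 : ℕ) : ℤ) ((i : ℤ) + 1) (((A * l) / ((7 : ℕ) - 1) + 1 : ℕ) : ℤ)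
        (((7 : ℕ) : ℤ) ^ a₀ - (a₀ : ℤ) * ((A * l : ℕ) : ℤ)) := by
  have h15 : A ∣ 15 := hAev (by decide)
  have h10 : A ∣ 10 := hA3 (by decide)
  have h6 : A ∣ 6 := hA5 (by decide)
  have hAg : A ∣ 1 := by
    have := Nat.dvd_gcd h15 h10
    have := Nat.dvd_gcd this h6
    simpa using this
  have hA : A = 1 := by
    have h1 : A ≤ 1 := Nat.le_of_dvd (by norm_num) hAg
    have h2 : 0 < A := Nat.pos_of_dvd_of_pos hAg (by norm_num)
    omega
  obtain ⟨j, hj⟩ := hodd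
  have hij : (i : ℤ) + 1 = (j : ℤ) := by
    have : i + 1 = j := by omega
    exact_mod_cast this
  rcases hA with rfl
  have hrin : (6 : ℤ) * (((((1 * l) / ((7 : ℕ) - 1) + 1 : ℕ) : ℤ))) ≤ 1 * (2 * (j : ℤ) + 1) + 6 := by
    have h0 : ((7 : ℕ) - 1) * ((1 * l) / ((7 : ℕ) - 1)) ≤ 1 * l := Nat.mul_div_le _ _
    have h1 : (6 : ℤ) * ((((1 * l) / ((7 : ℕ) - 1) : ℕ) : ℤ)) ≤ ((1 * l : ℕ) : ℤ) := by exact_mod_cast h0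
    push_cast at h1 ⊢; omega
  have he : ((1 * l : ℕ) : ℤ) = 1 * (2 * (j : ℤ) + 1) := by push_cast; omega
  have hm : ((1 * 30 : ℕ) : ℤ) = 30 := by norm_num
  by_cases hp0 : 481 ≤ l ∧ l ≤ 2057
  · refine ⟨3, fun s hs => ?_, ?_, ?_⟩
    · interval_cases s <;> norm_num <;> omega
    · norm_num; omega
    · have hro : (((7 : ℕ) : ℤ) ^ 3 - ((3 : ℕ) : ℤ) * ((1 * l : ℕ) : ℤ)) = 343 - 3 * (1 * (2 * (j : ℤ) + 1)) := by
        push_cast; omega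
      rw [hro, hij, he, hm]
      exact RefBand.not_hullCell_hex30_A1_a3 (by omega) (by omega) hrin
  by_cases hp1 : 2059 ≤ l ∧ l ≤ 14405
  · refine ⟨4, fun s hs => ?_, ?_, ?_⟩
    · interval_cases s <;> norm_num <;> omega
    · norm_num; omega
    · have hro : (((7 : ℕ) : ℤ) ^ 4 - ((4 : ℕ) : ℤ) * ((1 * l : ℕ) : ℤ)) = 2401 - 4 * (1 * (2 * (j : ℤ) + 1)) := by
        push_cast; omega
      rw [hro, hij, he, hm]
      exact RefBand.not_hullCell_hex30_A1_a4 (by omega) (by omega) hrin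
  by_cases hp2 : 14407 ≤ l ∧ l ≤ 100841
  · refine ⟨5, fun s hs => ?_, ?_, ?_⟩
    · interval_cases s <;> norm_num <;> omega
    · norm_num; omega
    · have hro : (((7 : ℕ) : ℤ) ^ 5 - ((5 : ℕ) : ℤ) * ((1 * l : ℕ) : ℤ)) = 16807 - 5 * (1 * (2 * (j : ℤ) + 1)) := by
        push_cast; omega
      rw [hro, hij, he, hm]
      exact RefBand.not_hullCell_hex30_A1_a5 (by omega) (by omega) hrin
  by_cases hp3 : 100843 ≤ l ∧ l ≤ 705893
  · refine ⟨6, fun s hs => ?_, ?_, ?_⟩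
    · interval_cases s <;> norm_num <;> omega
    · norm_num; omega
    · have hro : (((7 : ℕ) : ℤ) ^ 6 - ((6 : ℕ) : ℤ) * ((1 * l : ℕ) : ℤ)) = 117649 - 6 * (1 * (2 * (j : ℤ) + 1)) := by
        push_cast; omega
      rw [hro, hij, he, hm]
      exact RefBand.not_hullCell_hex30_A1_a6 (by omega) (by omega) hrin
  by_cases hp4 : 705895 ≤ l ∧ l ≤ 4941257
  · refine ⟨7, fun s hs => ?_, ?_, ?_⟩
    · interval_cases s <;> norm_num <;> omega
    · norm_num; omega
    · have hro : (((7 : ℕ) : ℤ) ^ 7 - ((7 : ℕ) : ℤ) * ((1 * l : ℕ) : ℤ)) = 823543 - 7 * (1 * (2 * (j : ℤ) + 1)) := by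
        push_cast; omega
      rw [hro, hij, he, hm]
      exact RefBand.not_hullCell_hex30_A1_a7 (by omega) (by omega) hrin
  by_cases hp5 : 4941259 ≤ l ∧ l ≤ 34588805
  · refine ⟨8, fun s hs => ?_, ?_, ?_⟩
    · interval_cases s <;> norm_num <;> omega
    · norm_num; omega
    · have hro : (((7 : ℕ) : ℤ) ^ 8 - ((8 : ℕ) : ℤ) * ((1 * l : ℕ) : ℤ)) = 5764801 - 8 * (1 * (2 * (j : ℤ) + 1)) := by
        push_cast; omega
      rw [hro, hij, he, hm]
      exact RefBand.not_hullCell_hex30_A1_a8 (by omega) (by omega) hrin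
  by_cases hp6 : 34588807 ≤ l ∧ l ≤ 242121641
  · refine ⟨9, fun s hs => ?_, ?_, ?_⟩
    · interval_cases s <;> norm_num <;> omega
    · norm_num; omega
    · have hro : (((7 : ℕ) : ℤ) ^ 9 - ((9 : ℕ) : ℤ) * ((1 * l : ℕ) : ℤ)) = 40353607 - 9 * (1 * (2 * (j : ℤ) + 1)) := by
        push_cast; omega
      rw [hro, hij, he, hm]
      exact RefBand.not_hullCell_hex30_A1_a9 (by omega) (by omega) hrin
  by_cases hp7 : 242121643 ≤ l ∧ l ≤ 1694851493
  · refine ⟨10, fun s hs => ?_, ?_, ?_⟩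
    · interval_cases s <;> norm_num <;> omega
    · norm_num; omega
    · have hro : (((7 : ℕ) : ℤ) ^ 10 - ((10 : ℕ) : ℤ) * ((1 * l : ℕ) : ℤ)) = 282475249 - 10 * (1 * (2 * (j : ℤ) + 1)) := by
        push_cast; omega
      rw [hro, hij, he, hm]
      exact RefBand.not_hullCell_hex30_A1_a10 (by omega) (by omega) hrin
  by_cases hp8 : 1694851495 ≤ l ∧ l ≤ 11863960457
  · refine ⟨11, fun s hs => ?_, ?_, ?_⟩
    · interval_cases s <;> norm_num <;> omega
    · norm_num; omega
    · have hro : (((7 : ℕ) : ℤ) ^ 11 - ((11 : ℕ) : ℤ) * ((1 * l : ℕ) : ℤ)) = 1977326743 - 11 * (1 * (2 * (j : ℤ) + 1)) := by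
        push_cast; omega
      rw [hro, hij, he, hm]
      exact RefBand.not_hullCell_hex30_A1_a11 (by omega) (by omega) hrin
  by_cases hp9 : 11863960459 ≤ l ∧ l ≤ 83047723205
  · refine ⟨12, fun s hs => ?_, ?_, ?_⟩
    · interval_cases s <;> norm_num <;> omega
    · norm_num; omega
    · have hro : (((7 : ℕ) : ℤ) ^ 12 - ((12 : ℕ) : ℤ) * ((1 * l : ℕ) : ℤ)) = 13841287201 - 12 * (1 * (2 * (j : ℤ) + 1)) := by
        push_cast; omega
      rw [hro, hij, he, hm]
      exact RefBand.not_hullCell_hex30_A1_a12 (by omega) (by omega) hrin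
  by_cases hp10 : 83047723207 ≤ l ∧ l ≤ 581334062441
  · refine ⟨13, fun s hs => ?_, ?_, ?_⟩
    · interval_cases s <;> norm_num <;> omega
    · norm_num; omega
    · have hro : (((7 : ℕ) : ℤ) ^ 13 - ((13 : ℕ) : ℤ) * ((1 * l : ℕ) : ℤ)) = 96889010407 - 13 * (1 * (2 * (j : ℤ) + 1)) := by
        push_cast; omega
      rw [hro, hij, he, hm]
      exact RefBand.not_hullCell_hex30_A1_a13 (by omega) (by omega) hrin
  by_cases hp11 : 581334062443 ≤ l ∧ l ≤ 4069338436823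
  · refine ⟨14, fun s hs => ?_, ?_, ?_⟩
    · interval_cases s <;> norm_num <;> omega
    · norm_num; omega
    · have hro : (((7 : ℕ) : ℤ) ^ 14 - ((14 : ℕ) : ℤ) * ((1 * l : ℕ) : ℤ)) = 678223072849 - 14 * (1 * (2 * (j : ℤ) + 1)) := by
        push_cast; omega
      rw [hro, hij, he, hm]
      exact RefBand.not_hullCell_hex30_A1_a14 (by omega) (by omega) hrin
  -- no level is left: the pieces cover the whole band
  exfalso; omega

end Summit.ABC.IUTFork.Conditional

end
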